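import Summits.BirchSwinnertonDyer.Rank1Residual.ManinAdditive.HalfTranslateTwistStep
import Literature.NumberTheory.EllipticCurves.PAdicLFunctionDistributionProofs
import HarnessLib

/-!
# The `ℚ(i)`-cusp pincer — ANALYTIC HALF, kernel (cell `bsd-f2-manin`, es g33, MEMO-es §54.2 steps (β)(γ)(δ); FILE A⁹⁺)

THEOREM 54.B.  For a weight-2 cusp form `f` on `Γ₀(N)` with real Fourier coefficients, vanishing even coefficients and
`16 ∣ N`, and a rational `r` such that some `γ ∈ Γ₀(N)` maps `−r` to `r + ½`, the modular symbol `{∞, r}_f` is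
ANTI-INVARIANT modulo periods: `{∞,r}_f + conj {∞,r}_f ∈ Λ_f`.  Proof = three tree theorems: the half-translation law
`modularSymbol_add_half_eq_neg` (γ), `modularSymbol_neg_eq_conj_holds` (δ), Manin's relation `modularSymbol_gamma0_smul_holds` (β).
THEOREM 54.C.  At `N = 16·m·d` with `d` odd, `gcd(m,d) = gcd(a,d) = 1`, `a` odd, an explicit `γ ∈ Γ₀(N)` with
`γ(−a/(4d)) = a/(4d) + ½` — so every `ℚ(i)`-cusp `a/(4d)` of `X₀(16M)` (`M = md` odd squarefree) has anti-invariant image.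
What remains of LEMMA 54.A on paper is the ARITHMETIC half ((α) cusp field, (ε)(ζ)(η) twist torsion).  Nothing is asserted.

TYPER NOTE (typer g21, T-es-60).  SOURCE = HOME/es/g33/QiCuspPincerAnalytic-es-g33.lean (FILE A⁹⁺) sha16 af13082f267883d1 (128 l.; es: farm rc 0 · 0
errors · 0 warnings · 0 s∗rry at 18:53Z; typer: own farm check rc 0 · 0 warnings) VERBATIM except this note.  THEOREM-ONLY companion (kind auto →
proof) of `QiCuspPincer.lean` (T-es-59, p738816), same namespace `…ManinAdditive.QiCuspPincer`, no name clash; imports `…ManinAdditive.HalfTranslateTwistStep`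
(Theses-free, 7 Summits modules in its cone) + `Literature…PAdicLFunctionDistributionProofs` + HarnessLib.  CONTENT (es MEMO-es §54.2 steps (β)(γ)(δ),
§54.3♯): THEOREM 54.B `modularSymbol_add_conj_mem_periodLattice_of_gamma0` (16 ∣ N, real coefficients, even coefficients zero, γ ∈ Γ₀(N) with
γ(−r) = r + ½ ⟹ {∞,r}_f + conj{∞,r}_f ∈ Λ_f — from the tree's `modularSymbol_add_half_eq_neg`, `modularSymbol_neg_eq_conj_holds`,
`modularSymbol_gamma0_smul_holds`), THEOREM 54.C `exists_gamma0_neg_smul_eq_add_half` (the explicit γ at N = 16·m·d), COR 54.D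
`modularSymbol_qiCusp_add_conj_mem_periodLattice` (the ℚ(i)-cusps a/(4d) of X₀(16M) have anti-invariant images).  These make steps (β)(γ)(δ) of
es's LEMMA 54.A (the analytic half of E-es-161's paper proof) KERNEL theorems; the arithmetic half ((α) cusp field, (ε)(ζ)(η) twist torsion)
stays on paper.  Nothing asserted; no conjecture node.  bears_on: stmt-BirchSwinnertonDyer-22967 (C2), carried here (`--supports` refused for
`…/ManinAdditive/` targets).  PARTITION 0 · beyond-print theorem: no · BSD is not proved by this; C2 OPEN.
-/

noncomputable section

open scoped MatrixGroups ModularForm ComplexConjugate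
open CongruenceSubgroup Complex Literature.NumberTheory.EllipticCurves
open Literature.NumberTheory.EllipticCurves.ModularForms

namespace Summit.BirchSwinnertonDyer.Rank1Residual.ManinAdditive.QiCuspPincer

variable {N : ℕ}

/-- **THEOREM 54.B (analytic pincer, kernel).** `16 ∣ N`, real coefficients, even coefficients zero, and a `γ ∈ Γ₀(N)`
with `γ(−r) = r + ½` ⟹ `{∞,r}_f + conj{∞,r}_f ∈ Λ_f`. -/
theorem modularSymbol_add_conj_mem_periodLattice_of_gamma0 [NeZero N] (f : CuspForm (Gamma0 N) 2)
    (hreal : ∀ n, (cuspCoeff f n).im = 0) (h16 : 4 ^ 2 ∣ N) (heven : ∀ n : ℕ, 2 ∣ n → cuspCoeff f n = 0)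
    (r : ℚ) (γ : Gamma0 N)
    (hr : ((γ : SL(2, ℤ)) 1 0 : ℚ) * (-r) + ((γ : SL(2, ℤ)) 1 1 : ℚ) ≠ 0)
    (hγ : (((γ : SL(2, ℤ)) 0 0 : ℚ) * (-r) + ((γ : SL(2, ℤ)) 0 1 : ℚ)) /
        (((γ : SL(2, ℤ)) 1 0 : ℚ) * (-r) + ((γ : SL(2, ℤ)) 1 1 : ℚ)) = r + 1 / 2) :
    modularSymbol f r + conj (modularSymbol f r) ∈ periodLattice f := by
  have h1 := modularSymbol_gamma0_smul_holds f γ (-r) hr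
  rw [hγ, modularSymbol_add_half_eq_neg f h16 heven r, modularSymbol_neg_eq_conj_holds f hreal] at h1
  have h2 : modularSymbol f r + conj (modularSymbol f r) = -cuspSymbol f γ := by
    linear_combination -h1
  rw [h2]
  exact (periodLattice f).neg_mem (cuspSymbol_mem_periodLattice f γ)

/-- **THEOREM 54.C (the explicit matrix, kernel).** For `N = 16·(m·d)`, `d` odd, `gcd(m,d) = 1`, `a` odd with
`gcd(a,d) = 1`, there is `γ ∈ Γ₀(N)` with `γ(−a/(4d)) = a/(4d) + ½` (and non-vanishing denominator, in fact `= 1`). -/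
theorem exists_gamma0_neg_smul_eq_add_half (m d : ℕ) (a : ℤ) (hd : Odd d) (ha : Odd a)
    (hmd : IsCoprime (m : ℤ) d) (had : IsCoprime a (d : ℤ)) :
    ∃ γ : Gamma0 (16 * (m * d)),
      ((γ : SL(2, ℤ)) 1 0 : ℚ) * (-((a : ℚ) / (4 * d))) + ((γ : SL(2, ℤ)) 1 1 : ℚ) ≠ 0 ∧
      (((γ : SL(2, ℤ)) 0 0 : ℚ) * (-((a : ℚ) / (4 * d))) + ((γ : SL(2, ℤ)) 0 1 : ℚ)) /
        (((γ : SL(2, ℤ)) 1 0 : ℚ) * (-((a : ℚ) / (4 * d))) + ((γ : SL(2, ℤ)) 1 1 : ℚ)) =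
        (a : ℚ) / (4 * d) + 1 / 2 := by
  -- `A := 4·m·a` is prime to `d`
  have h4 : IsCoprime (4 : ℤ) d := by
    have : Nat.Coprime (2 ^ 2) d := Nat.Coprime.pow_left 2 (Nat.coprime_two_left.mpr hd)
    exact_mod_cast Nat.isCoprime_iff_coprime.mpr this
  have hA : IsCoprime (4 * (m : ℤ) * a) d := (h4.mul_left hmd).mul_left had
  obtain ⟨x, y, hxy⟩ := hA
  -- `y` is odd (`d` odd, `4max` even)
  have hdZ : Odd (d : ℤ) := by exact_mod_cast hd
  have hy : Odd y := by
    have hyd : Odd (y * d) := ⟨-(2 * x * m * a), by linear_combination hxy⟩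
    exact (Int.odd_mul.mp hyd).1
  -- `β := (a·y + 2·y·d − 1)/2 ∈ ℤ`
  obtain ⟨b, hb⟩ : Even (a * y - 1 + 2 * (y * d)) := ((ha.mul hy).sub_odd odd_one).add (even_two_mul _)
  -- the matrix
  let A : Matrix (Fin 2) (Fin 2) ℤ :=
    !![2 * y * d - 1 - 16 * m * d * x, b; -(32 * m * d * x), 2 * y * d - 1]
  have hdet : A.det = 1 := by
    rw [Matrix.det_fin_two_of]
    linear_combination (4 * y * d) * hxy - (16 * m * d * x) * hb
  let g : SL(2, ℤ) := ⟨A, hdet⟩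
  have hg : g ∈ Gamma0 (16 * (m * d)) := by
    rw [Gamma0_mem]
    show (((-(32 * m * d * x) : ℤ)) : ZMod (16 * (m * d))) = 0
    have : (-(32 * m * d * x) : ℤ) = ((16 * (m * d) : ℕ) : ℤ) * (-(2 * x)) := by push_cast; ring
    rw [this, Int.cast_mul, Int.cast_natCast, ZMod.natCast_self, zero_mul]
  refine ⟨⟨g, hg⟩, ?_, ?_⟩
  · -- denominator = 1
    have e10 : (((⟨g, hg⟩ : Gamma0 (16 * (m * d))) : SL(2, ℤ)) 1 0 : ℤ) = -(32 * m * d * x) := rfl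
    have e11 : (((⟨g, hg⟩ : Gamma0 (16 * (m * d))) : SL(2, ℤ)) 1 1 : ℤ) = 2 * y * d - 1 := rfl
    have hd0 : (d : ℚ) ≠ 0 := by exact_mod_cast hd.pos.ne'
    rw [e10, e11]
    have hxyQ : (x : ℚ) * (4 * m * a) + y * d = 1 := by exact_mod_cast hxy
    have k : (-(32 * (m : ℚ) * d * x)) * (-((a : ℚ) / (4 * d))) = 8 * x * m * a := by
      field_simp
      ring
    have : ((-(32 * m * d * x) : ℤ) : ℚ) * (-((a : ℚ) / (4 * d))) + ((2 * y * d - 1 : ℤ) : ℚ) = 1 := by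
      push_cast
      rw [k]
      linear_combination 2 * hxyQ
    rw [this]; exact one_ne_zero
  · have e00 : (((⟨g, hg⟩ : Gamma0 (16 * (m * d))) : SL(2, ℤ)) 0 0 : ℤ) = 2 * y * d - 1 - 16 * m * d * x := rfl
    have e01 : (((⟨g, hg⟩ : Gamma0 (16 * (m * d))) : SL(2, ℤ)) 0 1 : ℤ) = b := rfl
    have e10 : (((⟨g, hg⟩ : Gamma0 (16 * (m * d))) : SL(2, ℤ)) 1 0 : ℤ) = -(32 * m * d * x) := rfl
    have e11 : (((⟨g, hg⟩ : Gamma0 (16 * (m * d))) : SL(2, ℤ)) 1 1 : ℤ) = 2 * y * d - 1 := rfl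
    have hd0 : (d : ℚ) ≠ 0 := by exact_mod_cast hd.pos.ne'
    rw [e00, e01, e10, e11]
    have hxyQ : (x : ℚ) * (4 * m * a) + y * d = 1 := by exact_mod_cast hxy
    have hbQ : (a : ℚ) * y - 1 + 2 * (y * d) = b + b := by exact_mod_cast hb
    have k : (-(32 * (m : ℚ) * d * x)) * (-((a : ℚ) / (4 * d))) = 8 * x * m * a := by
      field_simp
      ring
    have hden : ((-(32 * m * d * x) : ℤ) : ℚ) * (-((a : ℚ) / (4 * d))) + ((2 * y * d - 1 : ℤ) : ℚ) = 1 := by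
      push_cast
      rw [k]
      linear_combination 2 * hxyQ
    rw [hden, div_one]
    push_cast
    have k2 : ((2 : ℚ) * y * d - 1 - 16 * m * d * x) * (-((a : ℚ) / (4 * d))) =
        -(y * a / 2) + a / (4 * d) + 4 * x * m * a := by
      field_simp
      ring
    rw [k2]
    linear_combination hxyQ - (1 / 2 : ℚ) * hbQ

/-- **COR 54.D (kernel): the `ℚ(i)`-cusps of `X₀(16·m·d)` have anti-invariant images.** -/
theorem modularSymbol_qiCusp_add_conj_mem_periodLattice (m d : ℕ) [NeZero (16 * (m * d))]
    (f : CuspForm (Gamma0 (16 * (m * d))) 2)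
    (hreal : ∀ n, (cuspCoeff f n).im = 0) (heven : ∀ n : ℕ, 2 ∣ n → cuspCoeff f n = 0)
    (a : ℤ) (hd : Odd d) (ha : Odd a) (hmd : IsCoprime (m : ℤ) d) (had : IsCoprime a (d : ℤ)) :
    modularSymbol f ((a : ℚ) / (4 * d)) + conj (modularSymbol f ((a : ℚ) / (4 * d))) ∈ periodLattice f := by
  obtain ⟨γ, hr, hγ⟩ := exists_gamma0_neg_smul_eq_add_half m d a hd ha hmd had
  exact modularSymbol_add_conj_mem_periodLattice_of_gamma0 f hreal
    (Dvd.dvd.mul_right (by norm_num : 4 ^ 2 ∣ 16) (m * d)) heven _ γ hr hγ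

end Summit.BirchSwinnertonDyer.Rank1Residual.ManinAdditive.QiCuspPincer

end
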